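import Summits.BirchSwinnertonDyer.BirchSwinnertonDyer.Theorems.KimAtThreeFineKatoValueEquivarianceBridge
import Literature.NumberTheory.GaloisRepresentations.AbsGaloisOuterConj
import Literature.NumberTheory.GaloisRepresentations.TateLevelOneWildOdd
import Literature.NumberTheory.AdelicBaseChange.CyclotomicCompletionProofs
import HarnessLib

/-!
# The Galois half of (GAL_D): twisted tower cocycles and `g̃_* = τ̄` on the completion
# (crux `KatoKuriharaPortThreeShared`, stmt-BirchSwinnertonDyer-19560; cell `bsd-addord`, seat w2-acc5 gen 5;
# route W2 `KimAtThreeKolyvagin`; `--supports 19560`, helper)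

HONEST FRAMING.  TOOL theorems only (no definition, no named fact, no `sorry`); closes nothing; nothing is
booked; BSD is not proved by any of this.

WHAT.  The (C3a) clause of `ZetaBody` for the single-completion value datum is a kernel theorem modulo
the LOCAL equivariance (GAL_D) (`KimAtThreeFineKatoValueEquivarianceBridge`, every level).  The 19560 LEAD
(kim3 g15, HOME STATUS 2026-08-27T07:49Z) proves the `exp*`-half in the shape **(GAL_loc)**: for cocycles
`c, c'` of the tower representation with `c' τ = res_ℚ(δ') • c (s τ)` — `s` "conjugation by `δ'`
transported to `Γ_L`", `res_{K,L}(s τ) = δ'⁻¹ res τ δ'` — one has `exp*[c'] = g (exp*[c])` for the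
automorphism `g = τ̄_{δ'}` of `L` induced by `δ'`.  THIS FILE supplies the Galois half turning (GAL_loc)
into (GAL_D):

* §1 `exists_towerCocycles_conjMap` — **the twisted class has the twisted representative**: for
  `Y ∈ H¹(U, T)` and `δ' ∈ Γ_{ℚ_v}` there are tower cocycles `c`, `c'` representing
  `loc^{tower}(H1toInt Y)` and `loc^{tower}(H1toInt (res_ℚ δ' · Y))` with `c' τ = res_ℚ δ' • c (s τ)`
  for ANY `s` with `res(s τ) = δ'⁻¹ res τ δ'` (the tree's `absGaloisOuterConj ℚ_v F δ'⁻¹` is one).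
* §2 `galAdicCompletionMap_sigma_eq_absGaloisQuot` — **`(g̃)_* = τ̄`**: on the completion `L_{w₀}` of
  `L = ℚ(ζ_m)`, the transport `galAdicCompletionMap (sigma m (χ_m (res_ℚ δ')))` (GaloisActionPlaces)
  EQUALS the automorphism `absGaloisQuot ℚ_v L_{w₀} δ'` induced by `δ'` (AbsGaloisOuterConj) — both are
  `ℚ_v`-algebra maps sending `ζ ↦ ζ^{χ_m(δ')}` (`L_{w₀}/ℚ_v` is cyclotomic, w2-acc4
  `isCyclotomicExtension_adicCompletion_cyclotomicField`).
* §3 `galD_of_galLoc` — **(GAL_D) ⟸ (GAL_loc)**; `zetaBody_C3a_of_cocycleDef_of_galLoc` — **(C3a)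
  VERBATIM ⟸ (DEF₀) + (GAL_loc)**, every level.

References: J. Neukirch, *Algebraic Number Theory* (1999) Ch. IV §1, Ch. II §9 (9.6) [NeukirchANT1999];
J.-P. Serre, *Local Fields* (1979) VII §5; *Galois Cohomology* (1997) I §2.4 [SerreGaloisCohomology1997];
K. Kato, Astérisque 295 (2004) §9.4 [Kato2004Asterisque].
-/

noncomputable section

-- the cell's Theorems namespace `Summit.BirchSwinnertonDyer.BirchSwinnertonDyer.…` repeats the summit name by design (D-0017)
set_option linter.dupNamespace false

open scoped Classical NumberField ContRepresentation TensorProduct Pointwise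
open Field NumberField IsDedekindDomain Polynomial
open WeierstrassCurve Literature.NumberTheory.EllipticCurves Literature.NumberTheory.GaloisRepresentations
  Literature.NumberTheory.GaloisRepresentations.DiscreteGaloisModule
  Literature.NumberTheory.EllipticCurves.Kato2004.EulerSystemValues
open Literature.NumberTheory.AdelicBaseChange Literature.NumberTheory.Automorphic
open Summit.BirchSwinnertonDyer.Rank1Residual.GaloisImage
open Summit.BirchSwinnertonDyer.BirchSwinnertonDyer.Theorems.KimAtThreeFineKatoLevelCompat
open Summit.BirchSwinnertonDyer.BirchSwinnertonDyer.Theorems.KimAtThreeFineKatoLevelCompatDef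
open Summit.BirchSwinnertonDyer.BirchSwinnertonDyer.Theorems.KimAtThreeFineKatoValueEquivarianceBridge

namespace Summit.BirchSwinnertonDyer.BirchSwinnertonDyer.Theorems.KimAtThreeFineKatoValueEquivarianceLocal

/-! ## §1. The twisted tower class has the twisted representative -/

section Representatives

variable (W : WeierstrassCurve ℚ) [W.IsElliptic] (p : ℕ) [hp : Fact p.Prime]
  [ContinuousSMul ℤ_[p] (W.tateModule p)] (k : ℕ) (r : Finset (HeightOneSpectrum (𝓞 ℚ)))
  (v : HeightOneSpectrum (𝓞 ℚ)) (F : Type) [Field F] [Algebra (Place.Completion (Sum.inr v)) F]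

/-- **Representatives for (GAL_loc).**  Let `t : Γ_F → Γ_{ℚ_v} → Γ_ℚ` land in `U = cycSubgroup p k r`,
`δ' ∈ Γ_{ℚ_v}`, and `s : Γ_F → Γ_F` with `res_{ℚ_v,F}(s τ) = δ'⁻¹ · res τ · δ'`.  For every level class
`Y ∈ H¹(U, T_pW)` there are tower cocycles `c` representing `loc^{tower}(H1toInt Y)` and `c'`
representing `loc^{tower}(H1toInt (res_ℚ δ' · Y))` with **`c' τ = res_ℚ δ' • c (s τ)`** (on cocycles:
`(g · φ)(t τ) = g φ(g⁻¹ t(τ) g) = g φ(t(s τ))`). [cite: SerreGaloisCohomology1997, I §2.4 (compatible pairs)] -/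
theorem exists_towerCocycles_conjMap
    (hU : ∀ τ, absGaloisRestrictTower ℚ (Place.Completion (Sum.inr v)) F τ ∈ cycSubgroup p k r)
    (δ' : absoluteGaloisGroup (Place.Completion (Sum.inr v)))
    (s : absoluteGaloisGroup F → absoluteGaloisGroup F)
    (hs : ∀ τ, absGaloisRestrict (Place.Completion (Sum.inr v)) F (s τ) =
      δ'⁻¹ * absGaloisRestrict (Place.Completion (Sum.inr v)) F τ * δ')
    (Y : H1 (tateRep W p) (cycSubgroup p k r)) :
    ∃ c c' : contOneCocycles ((tateLocalRep W p (Sum.inr v)).restrict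
        (absGaloisRestrict (Place.Completion (Sum.inr v)) F)).toTopRep,
      locTower ℚ (Place.Completion (Sum.inr v)) F (tateRep W p).toIntRep.toTopRep (cycSubgroup p k r) hU 1
          (((tateRep W p).level (cycSubgroup p k r)).H1toInt Y) =
        (show ((tateLocalRep W p (Sum.inr v)).restrict
          (absGaloisRestrict (Place.Completion (Sum.inr v)) F)).cohomology 1 from oneCocycleClass _ c) ∧
      locTower ℚ (Place.Completion (Sum.inr v)) F (tateRep W p).toIntRep.toTopRep (cycSubgroup p k r) hU 1
          (((tateRep W p).level (cycSubgroup p k r)).H1toInt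
            (conjMap (tateRep W p).toTopRep (cycSubgroup p k r)
              (absGaloisRestrict ℚ (Place.Completion (Sum.inr v)) δ') 1 Y)) =
        (show ((tateLocalRep W p (Sum.inr v)).restrict
          (absGaloisRestrict (Place.Completion (Sum.inr v)) F)).cohomology 1 from oneCocycleClass _ c') ∧
      ∀ τ, c'.1 τ = (tateRep W p).toTopRep.ρ (absGaloisRestrict ℚ (Place.Completion (Sum.inr v)) δ')
        (c.1 (s τ)) := by
  obtain ⟨φ', rfl⟩ := oneCocycleClass_surjective (subgroupRep (tateRep W p).toTopRep (cycSubgroup p k r)) Y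
  obtain ⟨c, hc⟩ := exists_level_towerCocycle W p v F (cycSubgroup p k r) hU φ'
  let φg := contOneCocycles.pullback (subgroupConj (cycSubgroup p k r)
      (absGaloisRestrict ℚ (Place.Completion (Sum.inr v)) δ'))
    (conjRepHom (tateRep W p).toTopRep (cycSubgroup p k r)
      (absGaloisRestrict ℚ (Place.Completion (Sum.inr v)) δ')) φ'
  obtain ⟨c', hc'⟩ := exists_level_towerCocycle W p v F (cycSubgroup p k r) hU φg
  refine ⟨c, c', locTower_H1toInt_oneCocycleClass W p k r v F hU φ' c hc, ?_, fun τ => ?_⟩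
  · rw [conjMap_oneCocycleClass]
    exact locTower_H1toInt_oneCocycleClass W p k r v F hU φg c' hc'
  · rw [hc', hc]
    change (tateRep W p).toTopRep.ρ _ (φ'.1 (subgroupConj (cycSubgroup p k r) _ _)) = _
    congr 2
    apply Subtype.ext
    change (absGaloisRestrict ℚ (Place.Completion (Sum.inr v)) δ')⁻¹ *
        absGaloisRestrictTower ℚ (Place.Completion (Sum.inr v)) F τ *
        absGaloisRestrict ℚ (Place.Completion (Sum.inr v)) δ' =
      absGaloisRestrictTower ℚ (Place.Completion (Sum.inr v)) F (s τ)
    rw [absGaloisRestrictTower_apply, absGaloisRestrictTower_apply, hs, map_mul, map_mul, map_inv]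

end Representatives

/-! ## §2. `(g̃)_* = τ̄` on the completion `L_{w₀}` -/

section Quot

variable (p : ℕ) [hp : Fact p.Prime] (k : ℕ) (r : Finset (HeightOneSpectrum (𝓞 ℚ)))

set_option backward.isDefEq.respectTransparency false in
/-- **The transport `(g̃)_*` along `g̃ = sigma m (χ_m(res_ℚ δ'))` IS the automorphism of `L_{w₀}` induced
by `δ' ∈ Γ_{ℚ_v}`** (`absGaloisQuot`): both are `ℚ_v`-algebra endomorphisms of the cyclotomic extension
`L_{w₀} = ℚ_v(ζ)` (w2-acc4 `isCyclotomicExtension_adicCompletion_cyclotomicField`) sending `ζ ↦ ζ^{χ_m(δ')}`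
(`galAdicCompletionMap_coe_algEquiv` + `sigma_apply_zeta`, resp. `absEmbedding_absGaloisQuot_apply` +
the defining property of the cyclotomic character and `modNCyclotomicCharacter_absGaloisRestrict`).
[cite: NeukirchANT1999, Ch. II §9 Prop. (9.6)] [cite: Washington1997, Thm. 2.5] -/
theorem galAdicCompletionMap_sigma_eq_absGaloisQuot
    (w₀ : ((Rat.HeightOneSpectrum.primesEquiv (R := 𝓞 ℚ)).symm ⟨p, Fact.out⟩).Extension
      (𝓞 (CyclotomicField (cycLevel p k r) ℚ)))
    (δ' : absoluteGaloisGroup (((Rat.HeightOneSpectrum.primesEquiv (R := 𝓞 ℚ)).symm ⟨p, Fact.out⟩).adicCompletion ℚ))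
    (h : sigma (cycLevel p k r) (modNCyclotomicCharacter ℚ (cycLevel p k r)
      (absGaloisRestrict ℚ _ δ')) • w₀.1 = w₀.1)
    (x : w₀.1.adicCompletion (CyclotomicField (cycLevel p k r) ℚ)) :
    haveI := isGalois_adicCompletion_cyclotomicField (cycLevel p k r)
      ((Rat.HeightOneSpectrum.primesEquiv (R := 𝓞 ℚ)).symm ⟨p, Fact.out⟩) w₀
    galAdicCompletionMap (sigma (cycLevel p k r) (modNCyclotomicCharacter ℚ (cycLevel p k r)
      (absGaloisRestrict ℚ _ δ'))) h x =
      absGaloisQuot (((Rat.HeightOneSpectrum.primesEquiv (R := 𝓞 ℚ)).symm ⟨p, Fact.out⟩).adicCompletion ℚ)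
        (w₀.1.adicCompletion (CyclotomicField (cycLevel p k r) ℚ)) δ' x := by
  haveI hG := isGalois_adicCompletion_cyclotomicField (cycLevel p k r)
      ((Rat.HeightOneSpectrum.primesEquiv (R := 𝓞 ℚ)).symm ⟨p, Fact.out⟩) w₀
  haveI hC := isCyclotomicExtension_adicCompletion_cyclotomicField (cycLevel p k r)
      ((Rat.HeightOneSpectrum.primesEquiv (R := 𝓞 ℚ)).symm ⟨p, Fact.out⟩) w₀
  haveI : NeZero ((cycLevel p k r : ℕ) :
      ((Rat.HeightOneSpectrum.primesEquiv (R := 𝓞 ℚ)).symm ⟨p, Fact.out⟩).adicCompletion ℚ) :=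
    NeZero.nat_of_injective (algebraMap ℚ _).injective
  -- the two `ℚ_v`-algebra maps
  let f₁ : w₀.1.adicCompletion (CyclotomicField (cycLevel p k r) ℚ) →ₐ[((Rat.HeightOneSpectrum.primesEquiv (R := 𝓞 ℚ)).symm ⟨p, Fact.out⟩).adicCompletion ℚ]
      w₀.1.adicCompletion (CyclotomicField (cycLevel p k r) ℚ) :=
    { (galAdicCompletionMap (sigma (cycLevel p k r) (modNCyclotomicCharacter ℚ (cycLevel p k r)
        (absGaloisRestrict ℚ _ δ'))) h :
          w₀.1.adicCompletion (CyclotomicField (cycLevel p k r) ℚ) →+*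
            w₀.1.adicCompletion (CyclotomicField (cycLevel p k r) ℚ)) with
      commutes' := fun s => galAdicCompletionMap_algebraMap_adicCompletion _ _ w₀ w₀ h s }
  let f₂ : w₀.1.adicCompletion (CyclotomicField (cycLevel p k r) ℚ) →ₐ[((Rat.HeightOneSpectrum.primesEquiv (R := 𝓞 ℚ)).symm ⟨p, Fact.out⟩).adicCompletion ℚ]
      w₀.1.adicCompletion (CyclotomicField (cycLevel p k r) ℚ) :=
    (absGaloisQuot (((Rat.HeightOneSpectrum.primesEquiv (R := 𝓞 ℚ)).symm ⟨p, Fact.out⟩).adicCompletion ℚ)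
      (w₀.1.adicCompletion (CyclotomicField (cycLevel p k r) ℚ)) δ' :
        w₀.1.adicCompletion (CyclotomicField (cycLevel p k r) ℚ) ≃ₐ[_] _)
  -- the generator `ζ₁ = ι_{w₀}(ζ)` and its exponent `c = χ_m(res_ℚ δ')`
  have hζ := IsCyclotomicExtension.zeta_spec (cycLevel p k r) ℚ (CyclotomicField (cycLevel p k r) ℚ)
  have hζ₁ : IsPrimitiveRoot (algebraMap (CyclotomicField (cycLevel p k r) ℚ)
      (w₀.1.adicCompletion (CyclotomicField (cycLevel p k r) ℚ))
      (IsCyclotomicExtension.zeta (cycLevel p k r) ℚ (CyclotomicField (cycLevel p k r) ℚ))) (cycLevel p k r) :=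
    hζ.map_of_injective (algebraMap (CyclotomicField (cycLevel p k r) ℚ)
      (w₀.1.adicCompletion (CyclotomicField (cycLevel p k r) ℚ))).injective
  have hf : f₁ = f₂ := by
    refine (hζ₁.powerBasis (((Rat.HeightOneSpectrum.primesEquiv (R := 𝓞 ℚ)).symm ⟨p, Fact.out⟩).adicCompletion ℚ)).algHom_ext ?_
    rw [IsPrimitiveRoot.powerBasis_gen]
    -- `f₁ ζ₁ = ζ₁ ^ c`
    have h1 : f₁ (algebraMap _ _ (IsCyclotomicExtension.zeta (cycLevel p k r) ℚ (CyclotomicField (cycLevel p k r) ℚ))) =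
        (algebraMap (CyclotomicField (cycLevel p k r) ℚ) (w₀.1.adicCompletion (CyclotomicField (cycLevel p k r) ℚ))
          (IsCyclotomicExtension.zeta (cycLevel p k r) ℚ (CyclotomicField (cycLevel p k r) ℚ))) ^
          ((modNCyclotomicCharacter ℚ (cycLevel p k r) (absGaloisRestrict ℚ _ δ') : (ZMod (cycLevel p k r))ˣ) :
            ZMod (cycLevel p k r)).val := by
      change galAdicCompletionMap _ h ((IsCyclotomicExtension.zeta (cycLevel p k r) ℚ
        (CyclotomicField (cycLevel p k r) ℚ) : CyclotomicField (cycLevel p k r) ℚ) :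
          w₀.1.adicCompletion (CyclotomicField (cycLevel p k r) ℚ)) = _
      rw [galAdicCompletionMap_coe_algEquiv, sigma_apply_zeta, ← map_pow]
      rfl
    -- `f₂ ζ₁ = ζ₁ ^ c`: read through `absEmbedding`
    have h2 : f₂ (algebraMap _ _ (IsCyclotomicExtension.zeta (cycLevel p k r) ℚ (CyclotomicField (cycLevel p k r) ℚ))) =
        (algebraMap (CyclotomicField (cycLevel p k r) ℚ) (w₀.1.adicCompletion (CyclotomicField (cycLevel p k r) ℚ))
          (IsCyclotomicExtension.zeta (cycLevel p k r) ℚ (CyclotomicField (cycLevel p k r) ℚ))) ^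
          ((modNCyclotomicCharacter ℚ (cycLevel p k r) (absGaloisRestrict ℚ _ δ') : (ZMod (cycLevel p k r))ˣ) :
            ZMod (cycLevel p k r)).val := by
      apply (absEmbedding (((Rat.HeightOneSpectrum.primesEquiv (R := 𝓞 ℚ)).symm ⟨p, Fact.out⟩).adicCompletion ℚ)
        (w₀.1.adicCompletion (CyclotomicField (cycLevel p k r) ℚ))).injective
      change absEmbedding _ _ (absGaloisQuot _ _ δ' _) = _
      rw [absEmbedding_absGaloisQuot_apply, map_pow, modNCyclotomicCharacter_absGaloisRestrict]
      have hζ₀ : IsPrimitiveRoot (absEmbedding (((Rat.HeightOneSpectrum.primesEquiv (R := 𝓞 ℚ)).symm ⟨p, Fact.out⟩).adicCompletion ℚ)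
          (w₀.1.adicCompletion (CyclotomicField (cycLevel p k r) ℚ))
          (algebraMap _ _ (IsCyclotomicExtension.zeta (cycLevel p k r) ℚ (CyclotomicField (cycLevel p k r) ℚ))))
          (cycLevel p k r) :=
        hζ₁.map_of_injective
          (f := absEmbedding (((Rat.HeightOneSpectrum.primesEquiv (R := 𝓞 ℚ)).symm ⟨p, Fact.out⟩).adicCompletion ℚ)
            (w₀.1.adicCompletion (CyclotomicField (cycLevel p k r) ℚ)))
          (fun a b hab => (absEmbedding _ _).injective hab)
      exact modNCyclotomicCharacter_spec _ (cycLevel p k r) δ' _ hζ₀.pow_eq_one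
    rw [h1, h2]
  exact congrArg (fun f : _ →ₐ[_] _ => f x) hf

set_option backward.isDefEq.respectTransparency false in
/-- **«`δ'` induces `(g̃)_*` on `L_{w₀}`»** — the LEAD's binder `hg` for `g := galAdicCompletionMap g̃`: if
`ι y = x ∈ L_{w₀}` (`ι : \bar ℚ_v → \bar L_{w₀}` the chosen embedding) then `ι (δ' • y) = (g̃)_* x`
(§2 with `absEmbedding_absGaloisQuot_apply`). [cite: NeukirchANT1999, Ch. II §9 Prop. (9.6)] -/
theorem absClosureEmbedding_smul_eq_galAdicCompletionMap
    (w₀ : ((Rat.HeightOneSpectrum.primesEquiv (R := 𝓞 ℚ)).symm ⟨p, Fact.out⟩).Extension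
      (𝓞 (CyclotomicField (cycLevel p k r) ℚ)))
    (δ' : absoluteGaloisGroup (((Rat.HeightOneSpectrum.primesEquiv (R := 𝓞 ℚ)).symm ⟨p, Fact.out⟩).adicCompletion ℚ))
    (hδ : sigma (cycLevel p k r) (modNCyclotomicCharacter ℚ (cycLevel p k r)
      (absGaloisRestrict ℚ (((Rat.HeightOneSpectrum.primesEquiv (R := 𝓞 ℚ)).symm ⟨p, Fact.out⟩).adicCompletion ℚ) δ')) • w₀.1 = w₀.1)
    (y : AlgebraicClosure (((Rat.HeightOneSpectrum.primesEquiv (R := 𝓞 ℚ)).symm ⟨p, Fact.out⟩).adicCompletion ℚ)) (x : (w₀.1.adicCompletion (CyclotomicField (cycLevel p k r) ℚ)))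
    (hyx : absClosureEmbedding (((Rat.HeightOneSpectrum.primesEquiv (R := 𝓞 ℚ)).symm ⟨p, Fact.out⟩).adicCompletion ℚ) (w₀.1.adicCompletion (CyclotomicField (cycLevel p k r) ℚ)) y = algebraMap (w₀.1.adicCompletion (CyclotomicField (cycLevel p k r) ℚ)) (AlgebraicClosure (w₀.1.adicCompletion (CyclotomicField (cycLevel p k r) ℚ))) x) :
    absClosureEmbedding (((Rat.HeightOneSpectrum.primesEquiv (R := 𝓞 ℚ)).symm ⟨p, Fact.out⟩).adicCompletion ℚ) (w₀.1.adicCompletion (CyclotomicField (cycLevel p k r) ℚ)) (δ' • y) =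
      algebraMap (w₀.1.adicCompletion (CyclotomicField (cycLevel p k r) ℚ)) (AlgebraicClosure (w₀.1.adicCompletion (CyclotomicField (cycLevel p k r) ℚ)))
        (galAdicCompletionMap (sigma (cycLevel p k r) (modNCyclotomicCharacter ℚ (cycLevel p k r)
          (absGaloisRestrict ℚ (((Rat.HeightOneSpectrum.primesEquiv (R := 𝓞 ℚ)).symm ⟨p, Fact.out⟩).adicCompletion ℚ) δ'))) hδ x) := by
  haveI hG := isGalois_adicCompletion_cyclotomicField (cycLevel p k r) ((Rat.HeightOneSpectrum.primesEquiv (R := 𝓞 ℚ)).symm ⟨p, Fact.out⟩) w₀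
  haveI hC := isCyclotomicExtension_adicCompletion_cyclotomicField (cycLevel p k r) ((Rat.HeightOneSpectrum.primesEquiv (R := 𝓞 ℚ)).symm ⟨p, Fact.out⟩) w₀
  have hy : y = absEmbedding (((Rat.HeightOneSpectrum.primesEquiv (R := 𝓞 ℚ)).symm ⟨p, Fact.out⟩).adicCompletion ℚ) (w₀.1.adicCompletion (CyclotomicField (cycLevel p k r) ℚ)) x := by
    apply (absClosureEmbedding (((Rat.HeightOneSpectrum.primesEquiv (R := 𝓞 ℚ)).symm ⟨p, Fact.out⟩).adicCompletion ℚ) (w₀.1.adicCompletion (CyclotomicField (cycLevel p k r) ℚ))).injective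
    exact hyx.trans (absClosureEmbedding_absEmbedding (((Rat.HeightOneSpectrum.primesEquiv (R := 𝓞 ℚ)).symm ⟨p, Fact.out⟩).adicCompletion ℚ) (w₀.1.adicCompletion (CyclotomicField (cycLevel p k r) ℚ)) x).symm
  rw [hy, ← absEmbedding_absGaloisQuot_apply, absClosureEmbedding_absEmbedding,
    galAdicCompletionMap_sigma_eq_absGaloisQuot]

end Quot

/-! ## §3. (GAL_D) ⟸ (GAL_loc); (C3a) ⟸ (DEF₀) + (GAL_loc) -/

section Assembly

variable (W : WeierstrassCurve ℚ) [W.IsElliptic] (p : ℕ) [hp : Fact p.Prime]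
  [ContinuousSMul ℤ_[p] (W.tateModule p)] (k : ℕ) (r : Finset (HeightOneSpectrum (𝓞 ℚ)))
  (w₀ : ((Rat.HeightOneSpectrum.primesEquiv (R := 𝓞 ℚ)).symm ⟨p, Fact.out⟩).Extension
      (𝓞 (CyclotomicField (cycLevel p k r) ℚ)))
  [Algebra (Place.Completion (Sum.inr ((Rat.HeightOneSpectrum.primesEquiv (R := 𝓞 ℚ)).symm ⟨p, Fact.out⟩))) (w₀.1.adicCompletion (CyclotomicField (cycLevel p k r) ℚ))]
  (hU : ∀ τ, absGaloisRestrictTower ℚ (Place.Completion (Sum.inr ((Rat.HeightOneSpectrum.primesEquiv (R := 𝓞 ℚ)).symm ⟨p, Fact.out⟩))) (w₀.1.adicCompletion (CyclotomicField (cycLevel p k r) ℚ)) τ ∈ cycSubgroup p k r)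
  (φ₀ : ((tateLocalRep W p (Sum.inr ((Rat.HeightOneSpectrum.primesEquiv (R := 𝓞 ℚ)).symm ⟨p, Fact.out⟩))).restrict
    (absGaloisRestrict (Place.Completion (Sum.inr ((Rat.HeightOneSpectrum.primesEquiv (R := 𝓞 ℚ)).symm ⟨p, Fact.out⟩))) (w₀.1.adicCompletion (CyclotomicField (cycLevel p k r) ℚ)))).cohomology 1 →+ (w₀.1.adicCompletion (CyclotomicField (cycLevel p k r) ℚ)))

set_option backward.isDefEq.respectTransparency false in
/-- **(GAL_D) ⟸ (GAL_loc).**  If the defined `exp*_{w₀}` (an additive `φ₀` on the tower cohomology)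
satisfies the LEAD's cocycle-level semilinearity (GAL_loc) — `φ₀ [c'] = (g̃)_* (φ₀ [c])` whenever
`c' τ = res_ℚ δ' • c (s_{δ'} τ)`, for `δ' ∈ Γ_{ℚ_v}` whose image `g̃ = sigma m (χ_m (res_ℚ δ'))` fixes `w₀`
and a conjugation `s_{δ'}` with `res (s_{δ'} τ) = δ'⁻¹ res τ δ'` (e.g. `absGaloisOuterConj _ _ δ'⁻¹`) —
then (GAL_D) holds: `φ₀ (loc^{tower} (H1toInt (res_ℚ δ' · Y))) = (g̃)_* (φ₀ (loc^{tower} (H1toInt Y)))`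
(§1 supplies the representatives). [cite: SerreGaloisCohomology1997, I §2.4 (compatible pairs)] -/
theorem galD_of_galLoc
    (s : absoluteGaloisGroup (Place.Completion (Sum.inr ((Rat.HeightOneSpectrum.primesEquiv (R := 𝓞 ℚ)).symm ⟨p, Fact.out⟩))) → absoluteGaloisGroup (w₀.1.adicCompletion (CyclotomicField (cycLevel p k r) ℚ)) → absoluteGaloisGroup (w₀.1.adicCompletion (CyclotomicField (cycLevel p k r) ℚ)))
    (hs : ∀ δ' τ, absGaloisRestrict (Place.Completion (Sum.inr ((Rat.HeightOneSpectrum.primesEquiv (R := 𝓞 ℚ)).symm ⟨p, Fact.out⟩))) (w₀.1.adicCompletion (CyclotomicField (cycLevel p k r) ℚ)) (s δ' τ) =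
      δ'⁻¹ * absGaloisRestrict (Place.Completion (Sum.inr ((Rat.HeightOneSpectrum.primesEquiv (R := 𝓞 ℚ)).symm ⟨p, Fact.out⟩))) (w₀.1.adicCompletion (CyclotomicField (cycLevel p k r) ℚ)) τ * δ')
    (hloc : ∀ (δ' : absoluteGaloisGroup (Place.Completion (Sum.inr ((Rat.HeightOneSpectrum.primesEquiv (R := 𝓞 ℚ)).symm ⟨p, Fact.out⟩))))
      (hδ : sigma (cycLevel p k r) (modNCyclotomicCharacter ℚ (cycLevel p k r)
        (absGaloisRestrict ℚ (Place.Completion (Sum.inr ((Rat.HeightOneSpectrum.primesEquiv (R := 𝓞 ℚ)).symm ⟨p, Fact.out⟩))) δ')) • w₀.1 = w₀.1)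
      (c c' : contOneCocycles ((tateLocalRep W p (Sum.inr ((Rat.HeightOneSpectrum.primesEquiv (R := 𝓞 ℚ)).symm ⟨p, Fact.out⟩))).restrict
        (absGaloisRestrict (Place.Completion (Sum.inr ((Rat.HeightOneSpectrum.primesEquiv (R := 𝓞 ℚ)).symm ⟨p, Fact.out⟩))) (w₀.1.adicCompletion (CyclotomicField (cycLevel p k r) ℚ)))).toTopRep),
      (∀ τ, c'.1 τ = (tateRep W p).toTopRep.ρ (absGaloisRestrict ℚ (Place.Completion (Sum.inr ((Rat.HeightOneSpectrum.primesEquiv (R := 𝓞 ℚ)).symm ⟨p, Fact.out⟩))) δ') (c.1 (s δ' τ))) →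
      φ₀ (oneCocycleClass _ c') =
        galAdicCompletionMap (sigma (cycLevel p k r) (modNCyclotomicCharacter ℚ (cycLevel p k r)
          (absGaloisRestrict ℚ (Place.Completion (Sum.inr ((Rat.HeightOneSpectrum.primesEquiv (R := 𝓞 ℚ)).symm ⟨p, Fact.out⟩))) δ'))) hδ (φ₀ (oneCocycleClass _ c)))
    (δ' : absoluteGaloisGroup (Place.Completion (Sum.inr ((Rat.HeightOneSpectrum.primesEquiv (R := 𝓞 ℚ)).symm ⟨p, Fact.out⟩))))
    (hδ : sigma (cycLevel p k r) (modNCyclotomicCharacter ℚ (cycLevel p k r)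
      (absGaloisRestrict ℚ (Place.Completion (Sum.inr ((Rat.HeightOneSpectrum.primesEquiv (R := 𝓞 ℚ)).symm ⟨p, Fact.out⟩))) δ')) • w₀.1 = w₀.1)
    (Y : H1 (tateRep W p) (cycSubgroup p k r)) :
    φ₀ (locTower ℚ (Place.Completion (Sum.inr ((Rat.HeightOneSpectrum.primesEquiv (R := 𝓞 ℚ)).symm ⟨p, Fact.out⟩))) (w₀.1.adicCompletion (CyclotomicField (cycLevel p k r) ℚ)) (tateRep W p).toIntRep.toTopRep (cycSubgroup p k r) hU 1
      (((tateRep W p).level (cycSubgroup p k r)).H1toInt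
        (conjMap (tateRep W p).toTopRep (cycSubgroup p k r) (absGaloisRestrict ℚ (Place.Completion (Sum.inr ((Rat.HeightOneSpectrum.primesEquiv (R := 𝓞 ℚ)).symm ⟨p, Fact.out⟩))) δ') 1 Y))) =
      galAdicCompletionMap (sigma (cycLevel p k r) (modNCyclotomicCharacter ℚ (cycLevel p k r)
        (absGaloisRestrict ℚ (Place.Completion (Sum.inr ((Rat.HeightOneSpectrum.primesEquiv (R := 𝓞 ℚ)).symm ⟨p, Fact.out⟩))) δ'))) hδ
        (φ₀ (locTower ℚ (Place.Completion (Sum.inr ((Rat.HeightOneSpectrum.primesEquiv (R := 𝓞 ℚ)).symm ⟨p, Fact.out⟩))) (w₀.1.adicCompletion (CyclotomicField (cycLevel p k r) ℚ)) (tateRep W p).toIntRep.toTopRep (cycSubgroup p k r) hU 1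
          (((tateRep W p).level (cycSubgroup p k r)).H1toInt Y))) := by
  obtain ⟨c, c', hc, hc', hcc'⟩ := exists_towerCocycles_conjMap W p k r ((Rat.HeightOneSpectrum.primesEquiv (R := 𝓞 ℚ)).symm ⟨p, Fact.out⟩) (w₀.1.adicCompletion (CyclotomicField (cycLevel p k r) ℚ)) hU δ' (s δ') (hs δ') Y
  exact (congrArg φ₀ hc').trans ((hloc δ' hδ c c' hcc').trans (congrArg _ (congrArg φ₀ hc).symm))

set_option backward.isDefEq.respectTransparency false in
/-- **`ZetaBody` (C3a) VERBATIM ⟸ (DEF₀) + (GAL_loc)**, every level: the displayed cocycle-level definition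
(DEF₀) of the value datum through ONE completion, plus the LEAD's cocycle-level semilinearity (GAL_loc) of
the defined `exp*_{w₀}` for some conjugation maps `s_{δ'}` with `res (s_{δ'} τ) = δ'⁻¹ res τ δ'`, give
`Λ (σ · y) = (1 ⊗ σ̃) Λ(y)` for all `σ ∈ Γ_ℚ` (`galD_of_galLoc` ∘
`KimAtThreeFineKatoValueEquivarianceBridge.zetaBody_C3a_of_cocycleDef_of_galDecomposition`).
[cite: Kato2004Asterisque, §9.4 (p. 188)] [cite: NeukirchANT1999, Ch. I §9 and Ch. II §9 Prop. (9.6)] -/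
theorem zetaBody_C3a_of_cocycleDef_of_galLoc
    (Λ : H1 (tateRep W p) (cycSubgroup p k r) →ₗ[ℤ_[p]] ℚ_[p] ⊗[ℚ] CyclotomicField (cycLevel p k r) ℚ)
    (Ψ : ℚ_[p] ⊗[ℚ] CyclotomicField (cycLevel p k r) ℚ ≃ₐ[ℚ]
      (Π w : ((Rat.HeightOneSpectrum.primesEquiv (R := 𝓞 ℚ)).symm ⟨p, Fact.out⟩).Extension
        (𝓞 (CyclotomicField (cycLevel p k r) ℚ)), w.1.adicCompletion (CyclotomicField (cycLevel p k r) ℚ)))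
    (hΨ : ∀ (s : ℚ_[p]) (x : CyclotomicField (cycLevel p k r) ℚ)
      (w : ((Rat.HeightOneSpectrum.primesEquiv (R := 𝓞 ℚ)).symm ⟨p, Fact.out⟩).Extension
        (𝓞 (CyclotomicField (cycLevel p k r) ℚ))),
      Ψ (s ⊗ₜ[ℚ] x) w = algebraMap (CyclotomicField (cycLevel p k r) ℚ)
          (w.1.adicCompletion (CyclotomicField (cycLevel p k r) ℚ)) x *
        algebraMap (((Rat.HeightOneSpectrum.primesEquiv (R := 𝓞 ℚ)).symm ⟨p, Fact.out⟩).adicCompletion ℚ)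
          (w.1.adicCompletion (CyclotomicField (cycLevel p k r) ℚ)) (Padic.adicCompletionEquiv (𝓞 ℚ) ⟨p, Fact.out⟩ s))
    (g : ((Rat.HeightOneSpectrum.primesEquiv (R := 𝓞 ℚ)).symm ⟨p, Fact.out⟩).Extension
        (𝓞 (CyclotomicField (cycLevel p k r) ℚ)) → absoluteGaloisGroup ℚ)
    (hg : ∀ w : ((Rat.HeightOneSpectrum.primesEquiv (R := 𝓞 ℚ)).symm ⟨p, Fact.out⟩).Extension
        (𝓞 (CyclotomicField (cycLevel p k r) ℚ)),
      sigma (cycLevel p k r) (modNCyclotomicCharacter ℚ (cycLevel p k r) (g w)) • w.1 = w₀.1)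
    (hdef : ∀ (w : ((Rat.HeightOneSpectrum.primesEquiv (R := 𝓞 ℚ)).symm ⟨p, Fact.out⟩).Extension
        (𝓞 (CyclotomicField (cycLevel p k r) ℚ)))
      (y : H1 (tateRep W p) (cycSubgroup p k r))
      (φ'' : contOneCocycles (subgroupRep (tateRep W p).toTopRep (cycSubgroup p k r)))
      (ψT : contOneCocycles ((tateLocalRep W p (Sum.inr ((Rat.HeightOneSpectrum.primesEquiv (R := 𝓞 ℚ)).symm ⟨p, Fact.out⟩))).restrict
        (absGaloisRestrict (Place.Completion (Sum.inr ((Rat.HeightOneSpectrum.primesEquiv (R := 𝓞 ℚ)).symm ⟨p, Fact.out⟩))) (w₀.1.adicCompletion (CyclotomicField (cycLevel p k r) ℚ)))).toTopRep),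
      oneCocycleClass _ φ'' = conjMap (tateRep W p).toTopRep (cycSubgroup p k r) (g w) 1 y →
      (∀ σ, ψT.1 σ = φ''.1 ⟨absGaloisRestrictTower ℚ (Place.Completion (Sum.inr ((Rat.HeightOneSpectrum.primesEquiv (R := 𝓞 ℚ)).symm ⟨p, Fact.out⟩))) (w₀.1.adicCompletion (CyclotomicField (cycLevel p k r) ℚ)) σ, hU σ⟩) →
      Ψ (Λ y) w = galAdicCompletionMap
        (sigma (cycLevel p k r) (modNCyclotomicCharacter ℚ (cycLevel p k r) (g w)))⁻¹
        (inv_smul_eq_of_smul_eq (hg w)) (φ₀ (oneCocycleClass _ ψT)))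
    (s : absoluteGaloisGroup (Place.Completion (Sum.inr ((Rat.HeightOneSpectrum.primesEquiv (R := 𝓞 ℚ)).symm ⟨p, Fact.out⟩))) → absoluteGaloisGroup (w₀.1.adicCompletion (CyclotomicField (cycLevel p k r) ℚ)) → absoluteGaloisGroup (w₀.1.adicCompletion (CyclotomicField (cycLevel p k r) ℚ)))
    (hs : ∀ δ' τ, absGaloisRestrict (Place.Completion (Sum.inr ((Rat.HeightOneSpectrum.primesEquiv (R := 𝓞 ℚ)).symm ⟨p, Fact.out⟩))) (w₀.1.adicCompletion (CyclotomicField (cycLevel p k r) ℚ)) (s δ' τ) =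
      δ'⁻¹ * absGaloisRestrict (Place.Completion (Sum.inr ((Rat.HeightOneSpectrum.primesEquiv (R := 𝓞 ℚ)).symm ⟨p, Fact.out⟩))) (w₀.1.adicCompletion (CyclotomicField (cycLevel p k r) ℚ)) τ * δ')
    (hloc : ∀ (δ' : absoluteGaloisGroup (Place.Completion (Sum.inr ((Rat.HeightOneSpectrum.primesEquiv (R := 𝓞 ℚ)).symm ⟨p, Fact.out⟩))))
      (hδ : sigma (cycLevel p k r) (modNCyclotomicCharacter ℚ (cycLevel p k r)
        (absGaloisRestrict ℚ (Place.Completion (Sum.inr ((Rat.HeightOneSpectrum.primesEquiv (R := 𝓞 ℚ)).symm ⟨p, Fact.out⟩))) δ')) • w₀.1 = w₀.1)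
      (c c' : contOneCocycles ((tateLocalRep W p (Sum.inr ((Rat.HeightOneSpectrum.primesEquiv (R := 𝓞 ℚ)).symm ⟨p, Fact.out⟩))).restrict
        (absGaloisRestrict (Place.Completion (Sum.inr ((Rat.HeightOneSpectrum.primesEquiv (R := 𝓞 ℚ)).symm ⟨p, Fact.out⟩))) (w₀.1.adicCompletion (CyclotomicField (cycLevel p k r) ℚ)))).toTopRep),
      (∀ τ, c'.1 τ = (tateRep W p).toTopRep.ρ (absGaloisRestrict ℚ (Place.Completion (Sum.inr ((Rat.HeightOneSpectrum.primesEquiv (R := 𝓞 ℚ)).symm ⟨p, Fact.out⟩))) δ') (c.1 (s δ' τ))) →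
      φ₀ (oneCocycleClass _ c') =
        galAdicCompletionMap (sigma (cycLevel p k r) (modNCyclotomicCharacter ℚ (cycLevel p k r)
          (absGaloisRestrict ℚ (Place.Completion (Sum.inr ((Rat.HeightOneSpectrum.primesEquiv (R := 𝓞 ℚ)).symm ⟨p, Fact.out⟩))) δ'))) hδ (φ₀ (oneCocycleClass _ c)))
    (σ : absoluteGaloisGroup ℚ) (y : H1 (tateRep W p) (cycSubgroup p k r)) :
    Λ (conjMap (tateRep W p).toTopRep (cycSubgroup p k r) σ 1 y) =
      Algebra.TensorProduct.map (AlgHom.id ℚ ℚ_[p])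
        (sigma (cycLevel p k r) (modNCyclotomicCharacter ℚ (cycLevel p k r) σ) :
          CyclotomicField (cycLevel p k r) ℚ →ₐ[ℚ] CyclotomicField (cycLevel p k r) ℚ) (Λ y) :=
  zetaBody_C3a_of_cocycleDef_of_galDecomposition W p k r Λ Ψ w₀ hU g hΨ φ₀ hg hdef
    (galD_of_galLoc W p k r w₀ hU φ₀ s hs hloc) σ y

end Assembly

end Summit.BirchSwinnertonDyer.BirchSwinnertonDyer.Theorems.KimAtThreeFineKatoValueEquivarianceLocal

end
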